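import Summits.CriticalPhenomena.PercolationContinuityZ3.Theorems.PercNearOneGluingNoHeavyLowerTailLaminarLonelyRelayLocal
import Summits.CriticalPhenomena.PercolationContinuityZ3.Theorems.PercNearOneGluingNearOneGluingSingleFinger
import Summits.CriticalPhenomena.PercolationContinuityZ3.Theorems.PercNearOneGluingNearOneGluingWeightContinuity
import HarnessLib

/-!
# `NoHeavyLowerTail` (stmt-CriticalPhenomena-4575) — THE LAMINAR LONELY RELAY THEOREM
# (nested levels of candidate pockets never add up), all `|A|`, every laminar family, unconditional

Support file (factory prove seat `prim-ineq-prove-3`, gen 3; `--supports stmt-CriticalPhenomena-4575`); no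
definitions, no named facts.  Bond percolation with arbitrary edge probabilities on `Fin n` (`μ = prodBernoulli w`),
an observer `o`, relays `A`, `S = C(o) ∩ A` (`= A.filter (o ↔ ·)`), and a LAMINAR family `𝓛` of nonempty subsets of
`A` (any two members nested or disjoint).  THEOREM (`laminarLonelyRelay`):

  if `μ(L ↮ A∖R) ≤ t` for all members `L ⊆ R` of `𝓛`, then  `μ(S ∈ 𝓛) ≤ t`;

in particular (`laminarLonelyRelay_of_pairs`) if every member is a proper subset of `A` and `μ(a ↮ a') ≤ t` for all
distinct relays, then `μ(S ∈ 𝓛) ≤ t` — ONE pair-cut budget for the whole family.  Sharper form inside the proof: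
`μ(S ∈ 𝓛) ≤ Σ_{roots R} φ(R) · max_{L ⊆ R} μ(L ↮ A∖R)`, `φ(R) = P(o ↔ R | R ↮ A∖R)`, `Σ_{roots} φ(R) ≤ P(o ↔ A)`.
Special cases: an antichain of blocks is Kozma–Nitzan's Lemma 2 (`Theorems.blockLonelyRelay`, arXiv:2401.12397 p. 6);
a chain is the trivial chain bound; a bipartition with singletons is `Theorems.twoLevelLonelyRelay`; the FULL DYADIC
HIERARCHY on `A` (all `log₂|A|` levels) carries at most `max_a μ(a ↮ other half)`.  WHY IT MATTERS (seat memo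
FINDING-LAM.md, FINDING-SCALES.md): the `log |A|` loss of the one-cut line (`Theorems.oneCut_logLoss`) is the
possibility that every dyadic level of a pocket profile carries mass `t` (total `t · log₂|A|`); this theorem shows
that no LAMINAR family of candidate pockets can do that — uniformly in `|A|`, with constant `1` and without `P(o ↮ A)`
terms — so any such accumulation needs CROSSING pockets.

PROOF.  `local_bound` (file `…LaminarLonelyRelayLocal.lean`): by induction over the laminar tree, for every member
`R` and side event `J` = "all strict ancestors of `R` are joined to their outside",
`Σ_{R' ⊆ R} μ(S = R', J) ≤ φ(R) · max_{L ⊆ R} μ({L ↮ A∖R} ∩ J)` — on `{R ↮ A∖R}` the events `{S = R'}` are disjoint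
pieces of `{o ↔ R} ∩ {R ↮ A∖R} ∩ J` and two-set BHK negative correlation bounds them by `φ(R) μ({R ↮ A∖R} ∩ J)`; off
it, the children are handled by induction with the side event enlarged by "`R` joined to `A∖R`", and Kozma–Nitzan
Lemma 2 (`Σ_children φ ≤ φ(R)`) recombines.  At the roots, Lemma 2 once more (`Σ_roots φ(R) ≤ P(o ↔ A) ≤ 1`).  All
conditionings are made non-null by taking weights `< 1` (`laminar_pos`) and removed by weight continuity.
-/

namespace Summit.CriticalPhenomena.PercolationContinuityZ3.Theorems

open scoped BigOperators Classical Topology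
open MeasureTheory Set Filter
open Literature.Probability.LatticeModels (prodBernoulli)
open Literature.Probability.Percolation

variable {n : ℕ}

namespace TwoLevelLonelyRelay

/-- Every member lies below a root (maximal member); the family is the disjoint union, over its roots, of the
members below each root — as a sum identity. [folklore] -/
theorem sum_eq_sum_roots {𝓛 : Finset (Finset (Fin n))}
    (hlam : ∀ R ∈ 𝓛, ∀ T ∈ 𝓛, R ⊆ T ∨ T ⊆ R ∨ Disjoint R T) (hne𝓛 : ∀ R ∈ 𝓛, R.Nonempty)
    (f : Finset (Fin n) → ℝ) :
    ∑ R' ∈ 𝓛, f R' = ∑ R ∈ 𝓛.filter (fun R => ∀ T ∈ 𝓛, R ⊆ T → T = R),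
      ∑ R' ∈ 𝓛.filter (fun R' => R' ⊆ R), f R' := by
  have hcover : 𝓛 = (𝓛.filter (fun R => ∀ T ∈ 𝓛, R ⊆ T → T = R)).biUnion
      (fun R => 𝓛.filter (fun R' => R' ⊆ R)) := by
    ext R'
    simp only [Finset.mem_biUnion, Finset.mem_filter]
    constructor
    · intro hR'
      obtain ⟨R, hR, hR'R, hmax⟩ := exists_maximal_mem_superset 𝓛 hR'
      exact ⟨R, ⟨hR, fun T hT hRT => hmax T hT hRT⟩, hR', hR'R⟩
    · rintro ⟨R, -, hR', -⟩; exact hR'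
  conv_lhs => rw [hcover]
  rw [Finset.sum_biUnion]
  intro R hR R₂ hR₂ hne
  simp only [Function.onFun]
  refine Finset.disjoint_left.2 fun R' h1 h2 => hne ?_
  obtain ⟨hR𝓛, hRmax⟩ := Finset.mem_filter.1 (Finset.mem_coe.1 hR)
  obtain ⟨hR₂𝓛, hR₂max⟩ := Finset.mem_filter.1 (Finset.mem_coe.1 hR₂)
  have h1' := Finset.mem_filter.1 h1; have h2' := Finset.mem_filter.1 h2
  obtain ⟨x, hx⟩ := hne𝓛 R' h1'.1
  rcases hlam R hR𝓛 R₂ hR₂𝓛 with h | h | h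
  · exact (hRmax R₂ hR₂𝓛 h).symm
  · exact hR₂max R hR𝓛 h
  · exact absurd (Finset.disjoint_left.1 h (h1'.2 hx)) (fun h' => h' (h2'.2 hx))

/-- **Laminar lonely relay, non-null separation.**  With all relays pairwise separated with positive probability,
`μ(L ↮ A∖R) ≤ t` for all members `L ⊆ R` implies `μ(S ∈ 𝓛) ≤ t`.
[cite: KozmaNitzan2024, Lemma 2 (p. 6); VandenbergHaggstromKahn2005, Thm. 2.1 at q = 1] -/
theorem laminar_pos (w : Sym2 (Fin n) → unitInterval) (A : Finset (Fin n)) (o : Fin n)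
    (𝓛 : Finset (Finset (Fin n))) (hsubA : ∀ R ∈ 𝓛, R ⊆ A) (hne𝓛 : ∀ R ∈ 𝓛, R.Nonempty)
    (hlam : ∀ R ∈ 𝓛, ∀ T ∈ 𝓛, R ⊆ T ∨ T ⊆ R ∨ Disjoint R T) (t : ℝ) (ht : 0 ≤ t)
    (hpos : 0 < (prodBernoulli w).real
      {ω : BondConfig (Fin n) | ∀ x ∈ A, ∀ y ∈ A, x ≠ y → ω ∉ openConn x y})
    (hβ : ∀ L ∈ 𝓛, ∀ R ∈ 𝓛, L ⊆ R →
      (prodBernoulli w).real {ω | ∀ x ∈ L, ∀ y ∈ A \ R, ω ∉ openConn x y} ≤ t) :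
    (prodBernoulli w).real {ω : BondConfig (Fin n) | A.filter (fun a => ω ∈ openConn o a) ∈ 𝓛} ≤ t := by
  set μ := prodBernoulli w with hμ
  haveI : IsProbabilityMeasure μ := by rw [hμ]; infer_instance
  set RT := 𝓛.filter (fun R => ∀ T ∈ 𝓛, R ⊆ T → T = R) with hRT
  set φ : Finset (Fin n) → ℝ := fun X => μ.real ({ω | ∀ x ∈ X, ∀ y ∈ A \ X, ω ∉ openConn x y} ∩
      {ω | ∃ x ∈ X, ω ∈ openConn o x}) / μ.real {ω | ∀ x ∈ X, ∀ y ∈ A \ X, ω ∉ openConn x y} with hφ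
  have hφ0 : ∀ X, 0 ≤ φ X := fun X => div_nonneg measureReal_nonneg measureReal_nonneg
  -- the bad event as a disjoint union over the members
  have h1 : μ.real {ω : BondConfig (Fin n) | A.filter (fun a => ω ∈ openConn o a) ∈ 𝓛} =
      ∑ R' ∈ 𝓛, μ.real ({ω | A.filter (fun a => ω ∈ openConn o a) = R'} ∩ Set.univ) := by
    rw [← measureReal_biUnion_finset (pairwiseDisjoint_filter_eq A o 𝓛 Set.univ)
      (fun R' _ => MeasurableSet.of_discrete)]
    congr 1
    ext ω
    simp only [Set.mem_setOf_eq, Set.mem_iUnion, Set.mem_inter_iff, Set.mem_univ, and_true, exists_prop,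
      exists_eq_right']
  -- the empty set of ancestors: `J(∅) = univ`
  have hJ0 : {ω : BondConfig (Fin n) | ∀ Q ∈ (∅ : Finset (Finset (Fin n))), ∃ q ∈ Q, ∃ y ∈ A \ Q,
      ω ∈ openConn y q} = Set.univ := by
    ext ω; simp
  -- per root: the localized bound with no ancestors
  have h2 : ∀ R ∈ RT, ∑ R' ∈ 𝓛.filter (fun R' => R' ⊆ R),
      μ.real ({ω | A.filter (fun a => ω ∈ openConn o a) = R'} ∩ Set.univ) ≤ φ R * t := by
    intro R hR
    have hR𝓛 : R ∈ 𝓛 := (Finset.mem_filter.1 hR).1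
    obtain ⟨L, hL𝓛, hLR, hb⟩ := local_bound w A o 𝓛 hsubA hne𝓛 hlam hpos _ R hR𝓛 le_rfl ∅
      (fun Q hQ => absurd hQ (Finset.notMem_empty Q))
    rw [hJ0] at hb
    simp only [Set.inter_univ] at hb ⊢
    exact hb.trans (mul_le_mul_of_nonneg_left (hβ L hL𝓛 R hR𝓛 hLR) (hφ0 R))
  -- Lemma 2 at the roots: `Σ_roots φ(R) ≤ 1`
  have h3 : ∑ R ∈ RT, φ R ≤ 1 := by
    have hRTA : ∀ R ∈ RT, R ⊆ A := fun R hR => hsubA R (Finset.mem_filter.1 hR).1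
    have hRTdisj : ∀ R ∈ RT, ∀ R' ∈ RT, R ≠ R' → Disjoint R R' := by
      intro R hR R' hR' hne
      obtain ⟨hR𝓛, hRmax⟩ := Finset.mem_filter.1 hR
      obtain ⟨hR'𝓛, hR'max⟩ := Finset.mem_filter.1 hR'
      rcases hlam R hR𝓛 R' hR'𝓛 with h | h | h
      · exact absurd (hRmax R' hR'𝓛 h).symm hne
      · exact absurd (hR'max R hR𝓛 h) hne
      · exact h
    have hM : 0 < μ.real ({ω | ∀ x ∈ A, ∀ y ∈ A \ A, ω ∉ openConn x y} ∩
        {ω | ∀ T ∈ RT, ∀ x ∈ T, ∀ y ∈ A \ T, ω ∉ openConn x y}) := by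
      refine lt_of_lt_of_le hpos (measureReal_mono fun ω hω => ⟨fun x hx y hy => ?_, fun T hT x hx y hy => ?_⟩)
      · exact absurd (Finset.mem_sdiff.1 hy).1 (Finset.mem_sdiff.1 hy).2
      · exact hω x (hRTA T hT hx) y (Finset.mem_sdiff.1 hy).1 (fun h => (Finset.mem_sdiff.1 hy).2 (h ▸ hx))
    have key := lemma2_blocks_ratio w A A RT (Finset.Subset.refl A) hRTA hRTdisj o hM
    have hDA : {ω : BondConfig (Fin n) | ∀ x ∈ A, ∀ y ∈ A \ A, ω ∉ openConn x y} = Set.univ := by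
      ext ω
      simp only [Set.mem_setOf_eq, Set.mem_univ, iff_true]
      intro x _ y hy
      exact absurd (Finset.mem_sdiff.1 hy).1 (Finset.mem_sdiff.1 hy).2
    rw [hDA, probReal_univ, mul_one, Set.univ_inter] at key
    exact key.trans measureReal_le_one
  -- combine
  calc μ.real {ω : BondConfig (Fin n) | A.filter (fun a => ω ∈ openConn o a) ∈ 𝓛}
      = ∑ R' ∈ 𝓛, μ.real ({ω | A.filter (fun a => ω ∈ openConn o a) = R'} ∩ Set.univ) := h1
    _ = ∑ R ∈ RT, ∑ R' ∈ 𝓛.filter (fun R' => R' ⊆ R),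
          μ.real ({ω | A.filter (fun a => ω ∈ openConn o a) = R'} ∩ Set.univ) := sum_eq_sum_roots hlam hne𝓛 _
    _ ≤ ∑ R ∈ RT, φ R * t := Finset.sum_le_sum h2
    _ = (∑ R ∈ RT, φ R) * t := by rw [Finset.sum_mul]
    _ ≤ 1 * t := mul_le_mul_of_nonneg_right h3 ht
    _ = t := one_mul t

/-- **Laminar lonely relay, unconditional** (weight continuity removes the positivity hypothesis of
`laminar_pos`). [cite: KozmaNitzan2024, Lemma 2 (p. 6); this file] -/
theorem laminar_far (w : Sym2 (Fin n) → unitInterval) (A : Finset (Fin n)) (o : Fin n)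
    (𝓛 : Finset (Finset (Fin n))) (hsubA : ∀ R ∈ 𝓛, R ⊆ A) (hne𝓛 : ∀ R ∈ 𝓛, R.Nonempty)
    (hlam : ∀ R ∈ 𝓛, ∀ T ∈ 𝓛, R ⊆ T ∨ T ⊆ R ∨ Disjoint R T) (t : ℝ) (ht : 0 ≤ t)
    (hβ : ∀ L ∈ 𝓛, ∀ R ∈ 𝓛, L ⊆ R →
      (prodBernoulli w).real {ω | ∀ x ∈ L, ∀ y ∈ A \ R, ω ∉ openConn x y} ≤ t) :
    (prodBernoulli w).real {ω : BondConfig (Fin n) | A.filter (fun a => ω ∈ openConn o a) ∈ 𝓛} ≤ t := by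
  -- the scaled weights `w_k = (1 - 1/(k+1)) • w`, all `< 1`, converging to `w`
  have hcmem : ∀ k : ℕ, ((1 : ℝ) - 1 / ((k : ℝ) + 1)) ∈ unitInterval := by
    intro k
    have hk : (0 : ℝ) < (k : ℝ) + 1 := Nat.cast_add_one_pos k
    have h1 : 1 / ((k : ℝ) + 1) ≤ 1 := by
      rw [div_le_one hk]; linarith [(Nat.cast_nonneg k : (0 : ℝ) ≤ k)]
    have h0 : 0 ≤ 1 / ((k : ℝ) + 1) := by positivity
    exact ⟨by linarith, by linarith⟩
  set wk : ℕ → Sym2 (Fin n) → unitInterval :=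
    fun k e => ⟨(1 - 1 / ((k : ℝ) + 1)) * (w e : ℝ), unitInterval.mul_mem (hcmem k) (w e).2⟩
    with hwk_def
  have hwk_lt : ∀ k e, ((wk k e : unitInterval) : ℝ) < 1 := by
    intro k e
    have hc : (1 : ℝ) - 1 / ((k : ℝ) + 1) < 1 := by
      have : 0 < 1 / ((k : ℝ) + 1) := by positivity
      linarith
    calc ((wk k e : unitInterval) : ℝ) = (1 - 1 / ((k : ℝ) + 1)) * (w e : ℝ) := rfl
      _ ≤ (1 - 1 / ((k : ℝ) + 1)) := mul_le_of_le_one_right (hcmem k).1 (w e).2.2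
      _ < 1 := hc
  have hc_lim : Tendsto (fun k : ℕ => (1 : ℝ) - 1 / ((k : ℝ) + 1)) atTop (𝓝 1) := by
    simpa using tendsto_const_nhds.sub (tendsto_one_div_add_atTop_nhds_zero_nat (𝕜 := ℝ))
  have hwk_lim : Tendsto wk atTop (𝓝 w) := by
    refine tendsto_pi_nhds.2 fun e => ?_
    rw [tendsto_subtype_rng]
    have h := hc_lim.mul_const (w e : ℝ)
    rw [one_mul] at h
    exact h
  have hlimE : ∀ E : Set (Set (Sym2 (Fin n))),
      Tendsto (fun k => (prodBernoulli (wk k)).real E) atTop (𝓝 ((prodBernoulli w).real E)) :=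
    fun E => ((stub_weightContinuity n E).tendsto w).comp hwk_lim
  -- the error terms
  set δ : ℕ → ℝ := fun k => ∑ L ∈ 𝓛, ∑ R ∈ 𝓛,
      |(prodBernoulli (wk k)).real {ω | ∀ x ∈ L, ∀ y ∈ A \ R, ω ∉ openConn x y} -
        (prodBernoulli w).real {ω | ∀ x ∈ L, ∀ y ∈ A \ R, ω ∉ openConn x y}| with hδ_def
  have hδ0 : ∀ k, 0 ≤ δ k := fun k =>
    Finset.sum_nonneg fun L _ => Finset.sum_nonneg fun R _ => abs_nonneg _
  have hδ_lim : Tendsto δ atTop (𝓝 0) := by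
    have h1 : ∀ L ∈ 𝓛, Tendsto (fun k => ∑ R ∈ 𝓛,
        |(prodBernoulli (wk k)).real {ω | ∀ x ∈ L, ∀ y ∈ A \ R, ω ∉ openConn x y} -
          (prodBernoulli w).real {ω | ∀ x ∈ L, ∀ y ∈ A \ R, ω ∉ openConn x y}|) atTop (𝓝 0) := by
      intro L _
      have h2 : ∀ R ∈ 𝓛, Tendsto (fun k =>
          |(prodBernoulli (wk k)).real {ω | ∀ x ∈ L, ∀ y ∈ A \ R, ω ∉ openConn x y} -
            (prodBernoulli w).real {ω | ∀ x ∈ L, ∀ y ∈ A \ R, ω ∉ openConn x y}|) atTop (𝓝 0) := by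
        intro R _
        simpa using (tendsto_sub_nhds_zero_iff.2
          (hlimE {ω | ∀ x ∈ L, ∀ y ∈ A \ R, ω ∉ openConn x y})).abs
      simpa using tendsto_finsetSum 𝓛 h2
    simpa [hδ_def] using tendsto_finsetSum 𝓛 h1
  -- the bound at each `k`
  have hk : ∀ k, (prodBernoulli (wk k)).real
      {ω : BondConfig (Fin n) | A.filter (fun a => ω ∈ openConn o a) ∈ 𝓛} ≤ t + δ k := by
    intro k
    refine laminar_pos (wk k) A o 𝓛 hsubA hne𝓛 hlam (t + δ k) (by linarith [hδ0 k])
      (singleFinger_pairSep_real_pos (wk k) (hwk_lt k) A) ?_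
    intro L hL R hR hLR
    have h1 := hβ L hL R hR hLR
    have h2 : |(prodBernoulli (wk k)).real {ω | ∀ x ∈ L, ∀ y ∈ A \ R, ω ∉ openConn x y} -
          (prodBernoulli w).real {ω | ∀ x ∈ L, ∀ y ∈ A \ R, ω ∉ openConn x y}| ≤ δ k := by
      have h3 : |(prodBernoulli (wk k)).real {ω | ∀ x ∈ L, ∀ y ∈ A \ R, ω ∉ openConn x y} -
            (prodBernoulli w).real {ω | ∀ x ∈ L, ∀ y ∈ A \ R, ω ∉ openConn x y}| ≤
          ∑ R' ∈ 𝓛, |(prodBernoulli (wk k)).real {ω | ∀ x ∈ L, ∀ y ∈ A \ R', ω ∉ openConn x y} -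
            (prodBernoulli w).real {ω | ∀ x ∈ L, ∀ y ∈ A \ R', ω ∉ openConn x y}| :=
        Finset.single_le_sum (f := fun R' =>
          |(prodBernoulli (wk k)).real {ω | ∀ x ∈ L, ∀ y ∈ A \ R', ω ∉ openConn x y} -
            (prodBernoulli w).real {ω | ∀ x ∈ L, ∀ y ∈ A \ R', ω ∉ openConn x y}|)
          (fun R' _ => abs_nonneg _) hR
      have h4 : ∑ R' ∈ 𝓛, |(prodBernoulli (wk k)).real {ω | ∀ x ∈ L, ∀ y ∈ A \ R', ω ∉ openConn x y} -
            (prodBernoulli w).real {ω | ∀ x ∈ L, ∀ y ∈ A \ R', ω ∉ openConn x y}| ≤ δ k :=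
        Finset.single_le_sum (f := fun L' => ∑ R' ∈ 𝓛,
          |(prodBernoulli (wk k)).real {ω | ∀ x ∈ L', ∀ y ∈ A \ R', ω ∉ openConn x y} -
            (prodBernoulli w).real {ω | ∀ x ∈ L', ∀ y ∈ A \ R', ω ∉ openConn x y}|)
          (fun L' _ => Finset.sum_nonneg fun R' _ => abs_nonneg _) hL
      linarith
    have h5 := le_abs_self ((prodBernoulli (wk k)).real {ω | ∀ x ∈ L, ∀ y ∈ A \ R, ω ∉ openConn x y} -
        (prodBernoulli w).real {ω | ∀ x ∈ L, ∀ y ∈ A \ R, ω ∉ openConn x y})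
    linarith
  -- pass to the limit
  have hlimt : Tendsto (fun k => t + δ k) atTop (𝓝 t) := by
    simpa using tendsto_const_nhds.add hδ_lim
  exact le_of_tendsto_of_tendsto' (hlimE _) hlimt hk

end TwoLevelLonelyRelay

open TwoLevelLonelyRelay in
/-- **THE LAMINAR LONELY RELAY THEOREM** (all `|A|`, every laminar family, unconditional).  Bond percolation
with arbitrary edge probabilities on `Fin n`; an observer `o`; relays `A`; `𝓛` a laminar family of nonempty subsets
of `A` (any two members nested or disjoint); `S = C(o) ∩ A`.  If `μ(L ↮ A ∖ R) ≤ t` for all members `L ⊆ R`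
(equivalently: for every leaf `L` and its root `R`), then  `μ(S ∈ 𝓛) ≤ t`:  the whole laminar family of candidate
pockets carries at most ONE cut budget — its levels do not add up.  (Kozma–Nitzan's Lemma 2 is the antichain case;
the chain bound, `Theorems.twoLevelLonelyRelay` and the full dyadic hierarchy are special cases.)
[cite: KozmaNitzan2024, Lemma 2 (p. 6); VandenbergHaggstromKahn2005, Thm. 2.1 at q = 1] -/
theorem laminarLonelyRelay (n : ℕ) (w : Sym2 (Fin n) → unitInterval) (A : Finset (Fin n)) (o : Fin n)
    (𝓛 : Finset (Finset (Fin n))) (hsubA : ∀ R ∈ 𝓛, R ⊆ A) (hne𝓛 : ∀ R ∈ 𝓛, R.Nonempty)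
    (hlam : ∀ R ∈ 𝓛, ∀ T ∈ 𝓛, R ⊆ T ∨ T ⊆ R ∨ Disjoint R T) (t : ℝ) (ht : 0 ≤ t)
    (hβ : ∀ L ∈ 𝓛, ∀ R ∈ 𝓛, L ⊆ R →
      (prodBernoulli w).real {ω | ∀ x ∈ L, ∀ y ∈ A \ R, ω ∉ openConn x y} ≤ t) :
    (prodBernoulli w).real {ω : Set (Sym2 (Fin n)) | A.filter (fun a => ω ∈ openConn o a) ∈ 𝓛} ≤ t :=
  laminar_far w A o 𝓛 hsubA hne𝓛 hlam t ht hβ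

/-- **Laminar lonely relay, pairwise form.**  If every member of the laminar family `𝓛` is a nonempty PROPER
subset of `A` and `μ(a ↮ a') ≤ t` for all distinct relays, then `μ(S ∈ 𝓛) ≤ t` (`{L ↮ A∖R} ⊆ {x ↮ y}` for
`x ∈ L`, `y ∈ A ∖ R`).  Equality: `o` glued to one relay, the rest of `A` glued together.
[cite: KozmaNitzan2024, Lemma 2 (p. 6) — corollary] -/
theorem laminarLonelyRelay_of_pairs (n : ℕ) (w : Sym2 (Fin n) → unitInterval) (A : Finset (Fin n)) (o : Fin n)
    (𝓛 : Finset (Finset (Fin n))) (hsubA : ∀ R ∈ 𝓛, R ⊆ A) (hne𝓛 : ∀ R ∈ 𝓛, R.Nonempty)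
    (hproper : ∀ R ∈ 𝓛, (A \ R).Nonempty)
    (hlam : ∀ R ∈ 𝓛, ∀ T ∈ 𝓛, R ⊆ T ∨ T ⊆ R ∨ Disjoint R T) (t : ℝ) (ht : 0 ≤ t)
    (hpair : ∀ a ∈ A, ∀ a' ∈ A, a ≠ a' → (prodBernoulli w).real (openConn a a')ᶜ ≤ t) :
    (prodBernoulli w).real {ω : Set (Sym2 (Fin n)) | A.filter (fun a => ω ∈ openConn o a) ∈ 𝓛} ≤ t := by
  refine laminarLonelyRelay n w A o 𝓛 hsubA hne𝓛 hlam t ht fun L hL R hR hLR => ?_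
  obtain ⟨x, hx⟩ := hne𝓛 L hL
  obtain ⟨y, hy⟩ := hproper R hR
  have hxA : x ∈ A := hsubA L hL hx
  have hyA : y ∈ A := (Finset.mem_sdiff.1 hy).1
  have hne : x ≠ y := fun h => (Finset.mem_sdiff.1 hy).2 (h ▸ hLR hx)
  exact (measureReal_mono (fun ω hω => by
      simp only [Set.mem_setOf_eq, Set.mem_compl_iff] at hω ⊢; exact hω x hx y hy) (measure_ne_top _ _)).trans
    (hpair x hxA y hyA hne)

end Summit.CriticalPhenomena.PercolationContinuityZ3.Theorems
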